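import Literature.NumberTheory.EllipticCurves.NeronIsogenyScalingHoldsProofs
import Literature.NumberTheory.EllipticCurves.ModularSymbolsProofs
import HarnessLib

/-!
# The Néron squeeze: `Λ(D.f) ⊆ Λ_Néron(W₀)` for ONE globally minimal `W₀` forces `|c(D)| = 1`

Cell bsd-f2-manin, route `ManinLocalTwoThree`; the CM-free replacement (planner -an g50, MEMO-an §95) of
the hexagonal / Gaussian squeezes of `HexagonalSqueezeTwentySeven`, `GaussianSqueezeThirtyTwo`,
`HexagonalSqueezeThirtySix`.  Let `D` be an `X₀(N)`-parametrisation datum of a globally minimal `W/ℚ`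
with the lattice clause `Λ_W = c·Λ(D.f)` (`c = D.maninConstant`), and let `W₀/ℚ` be ANY globally
minimal elliptic curve with a Néron period pair `L₀` (`g₂(L₀) = c₄(W₀)/12`, `g₃(L₀) = c₆(W₀)/216`).
If the period lattice of the newform lies in that lattice, `Λ(D.f) ⊆ Λ(L₀)` (the analytic input
"(S2)"), then `(1/c)·Λ_W ⊆ Λ(L₀)`, so `1/c ∈ ℤ` by the tree's PROVED Néron-scaling fact
`integral_neronScaling_of_isGloballyMinimal_holds` (integrality of the Néron scaling of a rational
isogeny between globally minimal models), i.e. `|c| = 1` (`abs_maninConstant_eq_one_of_periodLattice_le`)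
— for every level `N`, with no complex multiplication, no reverse inclusion, no modularity of `W₀`, no
CDT and no printed Manin-constant fact.  Corollary: no prime divides `c`
(`not_dvd_maninConstant_of_periodLattice_le`).  BSD is not proved by this.
-/

set_option autoImplicit false
set_option linter.dupNamespace false

noncomputable section

open Complex
open Literature.NumberTheory.EllipticCurves Literature.NumberTheory.EllipticCurves.ModularForms

namespace Summit.BirchSwinnertonDyer.BirchSwinnertonDyer.Theorems.ManinLocalTwoThree.NeronSqueeze

/-- The Manin constant of a datum with the lattice clause is non-zero (`Λ_W = c·Λ_f` and `Λ_W ≠ 0`).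
[folklore] -/
theorem maninConstant_ne_zero_of_latticeClause {W : WeierstrassCurve ℚ} {N : ℕ} [NeZero N]
    (D : ModularParametrizationData W N)
    (hopt : ∀ z ∈ D.L.lattice, ∃ w ∈ periodLattice D.f, z = D.c * w) :
    D.maninConstant ≠ 0 := by
  intro hc
  have hω₁ : D.L.ω₁ ≠ 0 := by simpa using D.L.indep.ne_zero 0
  obtain ⟨w, -, hw⟩ := hopt D.L.ω₁ D.L.ω₁_mem_lattice
  rw [show D.c = D.maninConstant from rfl, hc, Int.cast_zero, zero_mul] at hw
  exact hω₁ hw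

/-- **The Néron squeeze.**  If `W₀/ℚ` is a globally minimal elliptic curve with Néron period pair `L₀`
and the period lattice of `D.f` lies in `Λ(L₀)`, then every `X₀(N)`-datum `D` of a globally minimal
`W/ℚ` with the lattice clause `Λ_W = c·Λ(D.f)` has `|c| = 1`: `(1/c)Λ_W ⊆ Λ(L₀)` and the Néron
scaling `1/c` of the rational isogeny `z ↦ z/c` between the globally minimal models `W`, `W₀` is an
integer. [cite: SilvermanATAEC1994, IV.5.1, IV.6.1, Cor. IV.9.1] [cite: AgasheRibetStein2006, §§1–2] -/
theorem abs_maninConstant_eq_one_of_periodLattice_le {N : ℕ} [NeZero N]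
    (W₀ : WeierstrassCurve ℚ) [W₀.IsElliptic] [W₀.IsGloballyMinimal] (L₀ : PeriodPair)
    (hL₀ : IsNeronLatticeOf (W₀.baseChange ℂ) L₀)
    (W : WeierstrassCurve ℚ) [W.IsElliptic] [W.IsGloballyMinimal] (D : ModularParametrizationData W N)
    (hS2 : ∀ z ∈ periodLattice D.f, z ∈ L₀.lattice)
    (hopt : ∀ z ∈ D.L.lattice, ∃ w ∈ periodLattice D.f, z = D.c * w) :
    |D.maninConstant| = 1 := by
  have hc0 : D.c ≠ 0 := maninConstant_ne_zero_of_latticeClause D hopt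
  have hcC : (D.c : ℂ) ≠ 0 := by exact_mod_cast hc0
  -- `(1/c) Λ_W ⊆ Λ(L₀)`
  have hincl : ∀ z ∈ D.L.lattice, (((D.c : ℚ)⁻¹ : ℚ) : ℂ) * z ∈ L₀.lattice := by
    intro z hz
    obtain ⟨w, hw, rfl⟩ := hopt z hz
    have : (((D.c : ℚ)⁻¹ : ℚ) : ℂ) * ((D.c : ℂ) * w) = w := by
      push_cast
      field_simp
    rw [this]
    exact hS2 w hw
  obtain ⟨k, hk⟩ := integral_neronScaling_of_isGloballyMinimal_holds W W₀ D.L L₀ D.isNeronLattice hL₀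
    ((D.c : ℚ)⁻¹) hincl
  -- `k · c = 1` in `ℤ`
  have hkc : k * D.c = 1 := by
    have h : (k : ℚ) * (D.c : ℚ) = 1 := by
      rw [hk, inv_mul_cancel₀ (by exact_mod_cast hc0)]
    exact_mod_cast h
  show |D.c| = 1
  rcases Int.eq_one_or_neg_one_of_mul_eq_one' hkc with ⟨-, h⟩ | ⟨-, h⟩ <;> simp [h]

/-- **Corollary: no integer `p` with `|p| ≠ 1` — in particular no prime — divides the Manin constant**
of such a datum. [folklore] -/
theorem not_dvd_maninConstant_of_periodLattice_le {N : ℕ} [NeZero N]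
    (W₀ : WeierstrassCurve ℚ) [W₀.IsElliptic] [W₀.IsGloballyMinimal] (L₀ : PeriodPair)
    (hL₀ : IsNeronLatticeOf (W₀.baseChange ℂ) L₀)
    (W : WeierstrassCurve ℚ) [W.IsElliptic] [W.IsGloballyMinimal] (D : ModularParametrizationData W N)
    (hS2 : ∀ z ∈ periodLattice D.f, z ∈ L₀.lattice)
    (hopt : ∀ z ∈ D.L.lattice, ∃ w ∈ periodLattice D.f, z = D.c * w)
    {p : ℤ} (hp : p.natAbs ≠ 1) : ¬ p ∣ D.maninConstant := by
  intro h
  have h1 := abs_maninConstant_eq_one_of_periodLattice_le W₀ L₀ hL₀ W D hS2 hopt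
  have hn : D.maninConstant.natAbs = 1 := by
    rw [Int.abs_eq_natAbs] at h1
    exact_mod_cast h1
  have h2 : p.natAbs ∣ 1 := hn ▸ Int.natAbs_dvd_natAbs.mpr h
  exact hp (Nat.dvd_one.mp h2)

end Summit.BirchSwinnertonDyer.BirchSwinnertonDyer.Theorems.ManinLocalTwoThree.NeronSqueeze

end
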